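import Literature.NumberTheory.Automorphic.JacquetRayExponents        -- ★ `Representation.exists_character_of_forall_mem_of_comm` (a common eigenvector of an abelian group)
import Mathlib.LinearAlgebra.Trace
import Mathlib.LinearAlgebra.FiniteDimensional.Lemmas
import HarnessLib

/-!
# F0 · P3c · line LH6 «StCharTS» — brick «TMULT» of organ (S-i): an ABELIAN group on a complex space of dimension `≤ 2` — the trace of every element is
# a sum of `dim` characters, each of which is a QUOTIENT character (admits a non-zero equivariant functional)

Cell `pub/hodgecm-mathlib`, crux H413 = `stmt-HodgeConjecture-24833` (lane `--supports … --as helper`), route HCCMUnconditional; seat LH6-p02 (g0), organ (S-i)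
`stub_StNoncuspidalMember` of the LH6 pay-down skeleton (v2 3bd6ede806aaa044 :297, ⊢ `aX π2 = 1` on the model `Gqs L v`).  THEOREMS ONLY, sorry-free, generic
linear algebra (Mathlib + ★ `JacquetRayExponents` §1).
HONEST LABEL: HC_CM is proved only modulo the printed citations (2 remaining named inputs hLiu418 24832, h413 24833) until rung 0 closes; this is the linear-algebra
step of the in-house road to (S-i) [Rogawski1990, proof of L. 12.7.3 p. 195]: the Jacquet modules `V_N(π)` of the four classes in the identity
`Tr πp − Tr πm = Tr π² + Tr πⁿ − χ^G_ξ` are representations of the ABELIAN diagonal torus `T` of dimension `≤ 2` (irreducible admissible `π` of `U(Φ₃)(L⁺_v)`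
embed into principal series, whose Jacquet module is `2`-dimensional [Casselman1995, L. 7.1.1]); by ★ R2d `Representation.smoothTrace_indicator_shell_eq` the
characters on the shells `K b K` are the traces `tr(π_N(b) | V_N)`, which THIS file writes as `Σ θ_i(b)` over `dim V_N ≤ 2` characters `θ_i : T →* ℂˣ`, each of them a
QUOTIENT character of `V_N` (so that, once the Vandermonde step ★ `F0P3cStCharTSVandermonde` has identified `θ_{π²}` among the `θ_i` of `V_N(πp)`, Frobenius ★
`F0P3cStCharTSPi2Id` applies).

* `trace_eq_zero_of_finrank_eq_zero` — dimension `0`.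
* `exists_char_of_finrank_eq_one` — dimension `1`: `τ m = θ(m)·1`, `tr τ(m) = θ(m)`, any non-zero functional is `θ`-equivariant.
* `exists_chars_of_finrank_eq_two` — dimension `2`: characters `θa` (a common eigen-line, ★ `exists_character_of_forall_mem_of_comm`) and `θb` (the quotient line) with
  `tr τ(m) = θa(m) + θb(m)` and BOTH admitting non-zero equivariant functionals (for `θa ≠ θb` through the commuting operator `τ(m₀) − θb(m₀)`, whose image is the eigen-line).
* `exists_multiset_of_finrank_le_two` — the packaged form: a multiset `s` of `finrank` characters with `tr τ(m) = Σ_{θ ∈ s} θ(m)` and every `θ ∈ s` a quotient character.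

## References
* [Casselman1995] W. Casselman, *Introduction to the theory of admissible representations of p-adic reductive groups* (1995): Prop. 2.1.9 (common eigenvectors of
  commuting operators), L. 7.1.1.
* [Rogawski1990] J. D. Rogawski, Ann. of Math. Stud. 123 (1990): §12.7 proof of Lemma 12.7.3 p. 195 («linear independence of characters of `M`»).
-/

set_option autoImplicit false
-- the mandated namespace has the single-problem summit's repeated segment (`HodgeConjecture.HodgeConjecture`)
set_option linter.dupNamespace false

noncomputable section

open Module
open scoped BigOperators

namespace Summit.HodgeConjecture.HodgeConjecture.Cruxes.H413.F0P3cStCharTSTorusMultiset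

variable {M W : Type*} [Group M] [AddCommGroup W] [Module ℂ W] [FiniteDimensional ℂ W] (τ : Representation ℂ M W)

/-! ## §0 A private helper -/

omit [FiniteDimensional ℂ W] in
/-- A linear form with `ℓ w₀ = 1` at a non-zero vector `w₀` (a left inverse of `a ↦ a • w₀`). [folklore] -/
private theorem exists_linearMap_apply_eq_one {w₀ : W} (hw₀ : w₀ ≠ 0) : ∃ ℓ : W →ₗ[ℂ] ℂ, ℓ w₀ = 1 := by
  obtain ⟨g, hg⟩ := LinearMap.exists_leftInverse_of_injective (LinearMap.toSpanSingleton ℂ W w₀)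
    (LinearMap.ker_toSpanSingleton ℂ hw₀)
  exact ⟨g, by simpa [LinearMap.toSpanSingleton_apply] using LinearMap.congr_fun hg (1 : ℂ)⟩

/-! ## §1 Dimension `0` and `1` -/

omit [FiniteDimensional ℂ W] in
/-- Dimension `0`: every trace vanishes. [cite: Casselman1995, Prop. 2.1.9] -/
theorem trace_eq_zero_of_subsingleton [Subsingleton W] (m : M) : LinearMap.trace ℂ W (τ m) = 0 := by
  rw [Subsingleton.elim (τ m) 0, map_zero]

/-- **Dimension `1`: `τ` acts by a character `θ`** — `τ m w = θ(m) • w` for all `w`. [cite: Casselman1995, Prop. 2.1.9] -/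
theorem exists_char_of_finrank_eq_one (hM : ∀ a b : M, a * b = b * a) (h1 : finrank ℂ W = 1) :
    ∃ θ : M →* ℂˣ, ∀ (m : M) (w : W), τ m w = ((θ m : ℂˣ) : ℂ) • w := by
  have hnt : Nontrivial W := (Module.finrank_pos_iff (R := ℂ)).1 (by rw [h1]; exact Nat.one_pos)
  have htop : (⊤ : Submodule ℂ W) ≠ ⊥ := by
    obtain ⟨x, hx⟩ := exists_ne (0 : W)
    exact fun h => hx ((Submodule.eq_bot_iff _).1 h x Submodule.mem_top)
  obtain ⟨θ, w₀, -, hw₀, hθ⟩ := Representation.exists_character_of_forall_mem_of_comm τ hM ⊤ htop (fun _ _ _ => Submodule.mem_top)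
  refine ⟨θ, fun m w => ?_⟩
  obtain ⟨c, rfl⟩ := (finrank_eq_one_iff_of_nonzero' w₀ hw₀).1 h1 w
  rw [map_smul, hθ m, smul_comm]

/-- Dimension `1`: `tr τ(m) = θ(m)` and there is a non-zero `θ`-equivariant functional (`θ` is a QUOTIENT character). [cite: Casselman1995, Prop. 2.1.9] -/
theorem trace_and_functional_of_finrank_eq_one (hM : ∀ a b : M, a * b = b * a) (h1 : finrank ℂ W = 1) :
    ∃ θ : M →* ℂˣ, (∀ m : M, LinearMap.trace ℂ W (τ m) = ((θ m : ℂˣ) : ℂ)) ∧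
      ∃ ψ : W →ₗ[ℂ] ℂ, ψ ≠ 0 ∧ ∀ (m : M) (w : W), ψ (τ m w) = ((θ m : ℂˣ) : ℂ) * ψ w := by
  obtain ⟨θ, hθ⟩ := exists_char_of_finrank_eq_one τ hM h1
  have hsc : ∀ m : M, τ m = ((θ m : ℂˣ) : ℂ) • (LinearMap.id : W →ₗ[ℂ] W) := fun m => by
    ext w; rw [hθ m w, LinearMap.smul_apply, LinearMap.id_apply]
  have hnt : Nontrivial W := (Module.finrank_pos_iff (R := ℂ)).1 (by rw [h1]; exact Nat.one_pos)
  obtain ⟨x, hx⟩ := exists_ne (0 : W)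
  obtain ⟨ψ, hψ⟩ := exists_linearMap_apply_eq_one (W := W) hx
  refine ⟨θ, fun m => ?_, ψ, fun h => ?_, fun m w => ?_⟩
  · rw [hsc m, map_smul, LinearMap.trace_id, h1, Nat.cast_one, smul_eq_mul, mul_one]
  · rw [h, LinearMap.zero_apply] at hψ; exact zero_ne_one hψ
  · rw [hθ m w, map_smul, smul_eq_mul]

/-! ## §2 Dimension `2` -/

/-- **Dimension `2`: two characters `θa, θb` with `tr τ(m) = θa(m) + θb(m)`, BOTH quotient characters.**  `θa` is the character of a common eigen-line
`ℂ w₁` (★ `exists_character_of_forall_mem_of_comm`), `θb` the character of the quotient `W ∕ ℂ w₁` (read in a basis `(w₁, w₂)`); the `θb`-functional is the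
second coordinate; the `θa`-functional is the second coordinate if `θa = θb`, and otherwise the first coordinate of the commuting operator
`A = τ(m₀) − θb(m₀)·1` (`θa(m₀) ≠ θb(m₀)`), whose image is the eigen-line. [cite: Casselman1995, Prop. 2.1.9] -/
theorem exists_chars_of_finrank_eq_two (hM : ∀ a b : M, a * b = b * a) (h2 : finrank ℂ W = 2) :
    ∃ θa θb : M →* ℂˣ, (∀ m : M, LinearMap.trace ℂ W (τ m) = ((θa m : ℂˣ) : ℂ) + ((θb m : ℂˣ) : ℂ)) ∧
      (∃ ψ : W →ₗ[ℂ] ℂ, ψ ≠ 0 ∧ ∀ (m : M) (w : W), ψ (τ m w) = ((θa m : ℂˣ) : ℂ) * ψ w) ∧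
      (∃ ψ : W →ₗ[ℂ] ℂ, ψ ≠ 0 ∧ ∀ (m : M) (w : W), ψ (τ m w) = ((θb m : ℂˣ) : ℂ) * ψ w) := by
  classical
  -- a common eigen-line `ℂ w₁` with character `θa`
  have hnt : Nontrivial W := (Module.finrank_pos_iff (R := ℂ)).1 (by rw [h2]; exact Nat.succ_pos 1)
  have htop : (⊤ : Submodule ℂ W) ≠ ⊥ := by
    obtain ⟨x, hx⟩ := exists_ne (0 : W)
    exact fun h => hx ((Submodule.eq_bot_iff _).1 h x Submodule.mem_top)
  obtain ⟨θa, w₁, -, hw₁, ha⟩ := Representation.exists_character_of_forall_mem_of_comm τ hM ⊤ htop (fun _ _ _ => Submodule.mem_top)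
  -- complete to a basis `b = (w₁, w₂)`
  obtain ⟨w₂, hli⟩ := exists_linearIndependent_pair_of_one_lt_finrank (by rw [h2]; exact Nat.lt_succ_self 1) hw₁
  let b : Basis (Fin 2) ℂ W := basisOfLinearIndependentOfCardEqFinrank hli (by rw [h2]; rfl)
  have hb0 : b 0 = w₁ := by rw [coe_basisOfLinearIndependentOfCardEqFinrank]; rfl
  have hb1 : b 1 = w₂ := by rw [coe_basisOfLinearIndependentOfCardEqFinrank]; rfl
  -- coordinates of `τ m (b 1)`: `τ m (b 1) = c m • b 0 + d m • b 1`
  let c : M → ℂ := fun m => b.repr (τ m (b 1)) 0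
  let d : M → ℂ := fun m => b.repr (τ m (b 1)) 1
  have hτ0 : ∀ m : M, τ m (b 0) = ((θa m : ℂˣ) : ℂ) • b 0 := fun m => by rw [hb0, ha m]
  have hτ1 : ∀ m : M, τ m (b 1) = c m • b 0 + d m • b 1 := fun m => by
    conv_lhs => rw [← b.sum_repr (τ m (b 1))]
    rw [Fin.sum_univ_two]
  have hrepr0 : ∀ m : M, b.repr (τ m (b 0)) = Finsupp.single 0 ((θa m : ℂˣ) : ℂ) := fun m => by
    rw [hτ0 m, map_smul, b.repr_self, Finsupp.smul_single, smul_eq_mul, mul_one]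
  have hrepr1 : ∀ m : M, b.repr (τ m (b 1)) = Finsupp.single 0 (c m) + Finsupp.single 1 (d m) := fun m => by
    conv_lhs => rw [hτ1 m]
    rw [map_add, map_smul, map_smul, b.repr_self, b.repr_self, Finsupp.smul_single, Finsupp.smul_single, smul_eq_mul, smul_eq_mul,
      mul_one, mul_one]
  -- `d` is a character: `d 1 = 1`, `d (m * n) = d m * d n`
  have hd1 : d 1 = 1 := by
    change b.repr (τ 1 (b 1)) 1 = 1
    rw [show τ 1 = (1 : Module.End ℂ W) from map_one τ, Module.End.one_apply, b.repr_self, Finsupp.single_eq_same]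
  have hdmul : ∀ m n : M, d (m * n) = d m * d n := fun m n => by
    change b.repr (τ (m * n) (b 1)) 1 = d m * d n
    rw [map_mul, Module.End.mul_apply, hτ1 n, map_add, map_smul, map_smul, hτ0 m, hτ1 m, smul_smul, smul_add, smul_smul, smul_smul,
      map_add, map_add, map_smul, map_smul, map_smul, b.repr_self, b.repr_self]
    simp [mul_comm]
  let dHom : M →* ℂ := { toFun := d, map_one' := hd1, map_mul' := hdmul }
  let θb : M →* ℂˣ := dHom.toHomUnits
  have hθb : ∀ m : M, ((θb m : ℂˣ) : ℂ) = d m := fun m => MonoidHom.coe_toHomUnits dHom m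
  -- the trace in the basis `b`
  have htr : ∀ m : M, LinearMap.trace ℂ W (τ m) = ((θa m : ℂˣ) : ℂ) + ((θb m : ℂˣ) : ℂ) := fun m => by
    rw [LinearMap.trace_eq_matrix_trace ℂ b, Matrix.trace_fin_two, LinearMap.toMatrix_apply, LinearMap.toMatrix_apply, hrepr0 m,
      hrepr1 m, hθb]
    simp
  -- the `θb`-functional: the second coordinate
  have hψb : ∀ (m : M) (w : W), b.coord 1 (τ m w) = ((θb m : ℂˣ) : ℂ) * b.coord 1 w := by
    intro m w
    conv_lhs => rw [← b.sum_repr w]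
    rw [Fin.sum_univ_two, map_add, map_smul, map_smul, hτ0 m, hτ1 m, hθb]
    simp only [map_add, map_smul, Basis.coord_apply, b.repr_self, Finsupp.single_apply, smul_eq_mul]
    conv_rhs => rw [← b.sum_repr w, Fin.sum_univ_two]
    simp
    ring
  have hψb0 : b.coord 1 ≠ 0 := fun h => by
    have := LinearMap.congr_fun h (b 1)
    rw [Basis.coord_apply, b.repr_self, Finsupp.single_eq_same, LinearMap.zero_apply] at this
    exact one_ne_zero this
  refine ⟨θa, θb, htr, ?_, ⟨b.coord 1, hψb0, hψb⟩⟩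
  -- the `θa`-functional
  by_cases hab : θa = θb
  · exact ⟨b.coord 1, hψb0, fun m w => by rw [hψb m w, hab]⟩
  · -- `m₀` with `θa m₀ ≠ θb m₀`; `A = τ m₀ − θb m₀ • 1` commutes with `τ` and has image in the eigen-line `ℂ b 0`
    obtain ⟨m₀, hm₀⟩ : ∃ m₀ : M, ((θa m₀ : ℂˣ) : ℂ) ≠ ((θb m₀ : ℂˣ) : ℂ) := by
      have hcon : ¬ ∀ m : M, ((θa m : ℂˣ) : ℂ) = ((θb m : ℂˣ) : ℂ) := fun h => hab (MonoidHom.ext fun m => Units.ext (h m))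
      exact not_forall.1 hcon
    let A : W →ₗ[ℂ] W := τ m₀ - ((θb m₀ : ℂˣ) : ℂ) • LinearMap.id
    have hA0 : A (b 0) = (((θa m₀ : ℂˣ) : ℂ) - ((θb m₀ : ℂˣ) : ℂ)) • b 0 := by
      simp only [A, LinearMap.sub_apply, LinearMap.smul_apply, LinearMap.id_apply, hτ0 m₀, sub_smul]
    have hA1 : A (b 1) = c m₀ • b 0 := by
      simp only [A, LinearMap.sub_apply, LinearMap.smul_apply, LinearMap.id_apply, hτ1 m₀, hθb]
      rw [add_sub_assoc, ← sub_smul, sub_self, zero_smul, add_zero]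
    -- `A x ∈ ℂ b 0`, i.e. its second coordinate vanishes, so `A x = coord₀(A x) • b 0`
    have hAspan : ∀ x : W, A x = b.coord 0 (A x) • b 0 := by
      intro x
      conv_lhs => rw [← b.sum_repr x]
      rw [Fin.sum_univ_two, map_add, map_smul, map_smul, hA0, hA1]
      conv_rhs => rw [← b.sum_repr x, Fin.sum_univ_two, map_add, map_smul, map_smul, hA0, hA1]
      simp only [Basis.coord_apply, smul_smul]
      simp
      rw [← add_smul]
    -- `A` commutes with every `τ m`
    have hcomm : ∀ (m : M) (x : W), A (τ m x) = τ m (A x) := by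
      intro m x
      simp only [A, LinearMap.sub_apply, LinearMap.smul_apply, LinearMap.id_apply, map_sub, map_smul]
      rw [← Module.End.mul_apply, ← map_mul, hM, map_mul, Module.End.mul_apply]
    refine ⟨(b.coord 0).comp A, fun h => ?_, fun m w => ?_⟩
    · have := LinearMap.congr_fun h (b 0)
      rw [LinearMap.comp_apply, hA0, map_smul, Basis.coord_apply, b.repr_self, Finsupp.single_eq_same, smul_eq_mul, mul_one,
        LinearMap.zero_apply] at this
      exact hm₀ (sub_eq_zero.1 this)
    · rw [LinearMap.comp_apply, LinearMap.comp_apply, hcomm m w]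
      have h1 : b.coord 0 (b 0) = 1 := by rw [Basis.coord_apply, b.repr_self, Finsupp.single_eq_same]
      conv_lhs => rw [hAspan w, map_smul, hτ0 m, map_smul, map_smul, h1]
      rw [smul_eq_mul, smul_eq_mul, mul_one, mul_comm]

/-! ## §3 The packaged form for dimension `≤ 2` -/

/-- **«TMULT»: for an abelian group on a complex space of dimension `≤ 2`, there is a multiset `s` of `finrank` characters with
`tr τ(m) = Σ_{θ ∈ s} θ(m)` for all `m`, each `θ ∈ s` admitting a non-zero `θ`-equivariant functional** (a QUOTIENT character of `W`).
[cite: Casselman1995, Prop. 2.1.9] [cite: Rogawski1990, §12.7 proof of Lemma 12.7.3 p. 195] -/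
theorem exists_multiset_of_finrank_le_two (hM : ∀ a b : M, a * b = b * a) (h2 : finrank ℂ W ≤ 2) :
    ∃ s : Multiset (M →* ℂˣ), Multiset.card s = finrank ℂ W ∧
      (∀ m : M, LinearMap.trace ℂ W (τ m) = (s.map fun θ : M →* ℂˣ => ((θ m : ℂˣ) : ℂ)).sum) ∧
      ∀ θ ∈ s, ∃ ψ : W →ₗ[ℂ] ℂ, ψ ≠ 0 ∧ ∀ (m : M) (w : W), ψ (τ m w) = ((θ m : ℂˣ) : ℂ) * ψ w := by
  rcases Nat.lt_or_ge (finrank ℂ W) 1 with h0 | h1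
  · -- dimension 0
    have h0' : finrank ℂ W = 0 := by omega
    haveI : Subsingleton W := (Module.finrank_zero_iff (R := ℂ)).1 h0'
    refine ⟨0, by rw [Multiset.card_zero, h0'], fun m => ?_, fun θ hθ => absurd hθ (Multiset.notMem_zero θ)⟩
    rw [trace_eq_zero_of_subsingleton τ m, Multiset.map_zero, Multiset.sum_zero]
  rcases Nat.lt_or_ge (finrank ℂ W) 2 with h1' | h2'
  · -- dimension 1
    have h1e : finrank ℂ W = 1 := by omega
    obtain ⟨θ, htr, ψ, hψ0, hψ⟩ := trace_and_functional_of_finrank_eq_one τ hM h1e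
    refine ⟨{θ}, by rw [Multiset.card_singleton, h1e], fun m => ?_, fun θ' hθ' => ?_⟩
    · rw [htr m, Multiset.map_singleton, Multiset.sum_singleton]
    · rw [Multiset.mem_singleton] at hθ'
      subst hθ'
      exact ⟨ψ, hψ0, hψ⟩
  · -- dimension 2
    have h2e : finrank ℂ W = 2 := le_antisymm h2 h2'
    obtain ⟨θa, θb, htr, ⟨ψa, hψa0, hψa⟩, ⟨ψb, hψb0, hψb⟩⟩ := exists_chars_of_finrank_eq_two τ hM h2e
    refine ⟨{θa, θb}, by rw [Multiset.card_pair, h2e], fun m => ?_, fun θ hθ => ?_⟩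
    · rw [htr m, Multiset.insert_eq_cons, Multiset.map_cons, Multiset.map_singleton, Multiset.sum_cons, Multiset.sum_singleton]
    · rw [Multiset.insert_eq_cons, Multiset.mem_cons, Multiset.mem_singleton] at hθ
      rcases hθ with rfl | rfl
      · exact ⟨ψa, hψa0, hψa⟩
      · exact ⟨ψb, hψb0, hψb⟩

end Summit.HodgeConjecture.HodgeConjecture.Cruxes.H413.F0P3cStCharTSTorusMultiset

end
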